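import Summits.QuantumFields.YangMills.Theorems.LuscherReductionTwistedTraceScalingValleySkeleton
import HarnessLib

/-!
# `ValleyGeomAt` from LINK PROXIMITY to a twisted flat background: the geometry sub-target of the C3 skeleton reduced to a pure link-distance statement
# (lane A of S-BASE, crux `TwistedTraceScaling` stmt-QuantumFields-20203; design note `pub/ym-fleet/ym-luscher-20007-p1/COARSE-DESIGN.md` §16)

`ValleyGeomAt L δ η` (`…ValleySkeleton`) asks, at every valley point `U`, for a gauge copy `g·V_θ` of a flat abelian background with (i) `‖D_U v − D_{g·V_θ}v‖ ≤ εδ‖v‖` and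
(ii) a twist bound `c₀δ ≤ ‖2θ_k‖`.  Both follow from LINK PROXIMITY alone:
* `ValleyLinkProxAt L δ η` — for every `ε > 0`, eventually in `β`, every `U ∈ valleySet` is `U = W·(g·V_θ)` with a kinetic step `W` in the upper hemisphere and
  `|vecPart(W_e)_c| ≤ ε·δ(β)` on every link (the Łojasiewicz-1/4 statement of §16 in its natural currency; OPEN, target text);
* (i) is lane B's `norm_covCurl_step_sub_le` (`‖D_{W·V} − D_V‖ ≤ 504τ√N`); (ii): `‖W_e − 1‖_F ≤ 2|w_e| ≤ 2√3·εδ`, so every twisted orbit distance of `g·V_θ` exceeds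
  `δ/2 − 2√3|E|εδ ≥ δ/4` (`abs_orbitDist_twist3_sub_le`, `orbitDist_twist3_gaugeTransform`), and `exists_norm_gt_of_valley` gives `‖2θ_k‖ > √2(δ/4)/(3L³)`;
* ★★ `valleyGeomAt_of_linkProx : ValleyLinkProxAt L δ η → (∀ β, 0 < δ β) → ValleyGeomAt L δ η` (`c₀ = √2/(12L³)`), and the corollary
  ★★★ `coarseNoIntruderAt_of_bo_linkProx_pow : 0<p<1/3 → q<8/9 → ValleyBOAt L (β^{−p}) (β^{−q}) → ValleyLinkProxAt L (β^{−p}) (β^{−q}) → InnerNoIntruderOneOrbitAt L (β^{−p}) → COARSE-UPPER(L)`.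
What remains for the geometry is therefore exactly: «valley point ⇒ `o(δ)`-link-close to a gauge copy of some `V_θ`» = comb-gauge propagation + almost-commuting `SU(2)`
(`…AlmostCommutingSU2`) + «common-axis comb configuration = `g·abelianCfg θ`».
HONEST FRAMING: bookkeeping for a stub lane of a child of the CONDITIONAL reduction route (femto rung R2b1); not a gap, not Clay.
-/

set_option autoImplicit false

noncomputable section

open MeasureTheory Filter Topology Real Module
open scoped BigOperators InnerProductSpace Matrix
open Literature.MathematicalPhysics.QuantumFieldTheory
open Literature.MathematicalPhysics.QuantumLattice

namespace Summit.QuantumFields.YangMills.Theorems.FemtoTransferGap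

open TwoLattice TwoLattice.Toron TwoLattice.Cov TwoLattice.Stiff

variable (L : ℕ) [NeZero L]

/-- **Sub-target LINK PROXIMITY** (OPEN; the Łojasiewicz half of C3c-LOW): for every `ε > 0`, eventually in `β`, every point of the valley set is a kinetic step of size
`≤ ε·δ(β)` (componentwise, upper hemisphere) away from a gauge copy of a flat abelian background: `U = W·(g·V_θ)`.  Target text of this programme (Lüscher 1983 §2),
not a published theorem. -/
def ValleyLinkProxAt (δ η : ℝ → ℝ) : Prop :=
  ∀ ε : ℝ, 0 < ε → ∃ β0 : ℝ, ∀ β : ℝ, β0 ≤ β →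
    ∀ U ∈ valleySet L (δ β) (η β), ∃ (W : GaugeConfig 3 L SU2) (g : Site 3 L → SU2) (θ : Fin 3 → ℝ),
      U = W * gaugeTransform g (abelianCfg L θ) ∧ (∀ e, 0 ≤ scalarPart (W e)) ∧ ∀ (e : Edge 3 L) (c : Fin 3), |vecPart (W e) c| ≤ ε * δ β

variable {L}

/-! ## §1 A small kinetic step moves every twisted orbit distance by little -/

/-- `‖W − 1‖_F ≤ 2·√3·τ` for an upper-hemisphere element with vector components `≤ τ`. [folklore] -/
theorem frobNorm_sub_one_le_of_step {W : SU2} (hs : 0 ≤ scalarPart W) {τ : ℝ} (hw : ∀ c, |vecPart W c| ≤ τ) :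
    frobNorm (((W : SU2) : Matrix (Fin 2) (Fin 2) ℂ) - 1) ≤ 2 * Real.sqrt 3 * τ := by
  have hτ : 0 ≤ τ := (abs_nonneg _).trans (hw 0)
  have hsq : frobNorm (((W : SU2) : Matrix (Fin 2) (Fin 2) ℂ) - 1) ^ 2 ≤ (2 * Real.sqrt 3 * τ) ^ 2 := by
    rw [frobNorm_sub_one_sq_eq_scalarPart]
    have h1 : 1 - scalarPart W ≤ ∑ a, vecPart W a ^ 2 := by
      rw [sum_vecPart_sq]; have := abs_scalarPart_le W; rw [abs_le] at this; nlinarith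
    have h2 : ∑ a, vecPart W a ^ 2 ≤ 3 * τ ^ 2 := by
      have hc : ∀ c, vecPart W c ^ 2 ≤ τ ^ 2 := fun c => by
        rw [← sq_abs]; exact pow_le_pow_left₀ (abs_nonneg _) (hw c) 2
      rw [Fin.sum_univ_three]; linarith [hc 0, hc 1, hc 2]
    have h3 : (2 * Real.sqrt 3 * τ) ^ 2 = 12 * τ ^ 2 := by
      rw [mul_pow, mul_pow, Real.sq_sqrt (by norm_num : (0:ℝ) ≤ 3)]; ring
    rw [h3]; linarith
  exact (pow_le_pow_iff_left₀ (frobNorm_nonneg _) (by positivity) two_ne_zero).mp hsq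

/-- The link distance between `W·V` and `V`: `Σ_e ‖(W·V)_e − V_e‖_F = Σ_e ‖W_e − 1‖_F ≤ |E|·2√3·τ`. [folklore] -/
theorem sum_frobNorm_step_sub_le (W V : GaugeConfig 3 L SU2) (hs : ∀ e, 0 ≤ scalarPart (W e)) {τ : ℝ} (hw : ∀ (e : Edge 3 L) (c : Fin 3), |vecPart (W e) c| ≤ τ) :
    ∑ e : Edge 3 L, frobNorm ((((W * V) e : SU2) : Matrix (Fin 2) (Fin 2) ℂ) - ((V e : SU2) : Matrix (Fin 2) (Fin 2) ℂ)) ≤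
      Fintype.card (Edge 3 L) * (2 * Real.sqrt 3 * τ) := by
  calc ∑ e : Edge 3 L, frobNorm ((((W * V) e : SU2) : Matrix (Fin 2) (Fin 2) ℂ) - ((V e : SU2) : Matrix (Fin 2) (Fin 2) ℂ))
      = ∑ e : Edge 3 L, frobNorm (((W e : SU2) : Matrix (Fin 2) (Fin 2) ℂ) - 1) := Finset.sum_congr rfl fun e _ => by
          rw [Pi.mul_apply, Submonoid.coe_mul]
          have h : ((W e : SU2) : Matrix (Fin 2) (Fin 2) ℂ) * ((V e : SU2) : Matrix (Fin 2) (Fin 2) ℂ) - ((V e : SU2) : Matrix (Fin 2) (Fin 2) ℂ) =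
              (((W e : SU2) : Matrix (Fin 2) (Fin 2) ℂ) - 1) * ((V e : SU2) : Matrix (Fin 2) (Fin 2) ℂ) := by rw [Matrix.sub_mul, Matrix.one_mul]
          rw [h, frobNorm_mul_unitary _ (su2_mem_unitaryGroup _)]
    _ ≤ ∑ _e : Edge 3 L, 2 * Real.sqrt 3 * τ := Finset.sum_le_sum fun e _ => frobNorm_sub_one_le_of_step (hs e) (hw e)
    _ = Fintype.card (Edge 3 L) * (2 * Real.sqrt 3 * τ) := by rw [Finset.sum_const, Finset.card_univ, nsmul_eq_mul]

/-- ★ **A small step off a valley point keeps the flat background away from the torons**: if `U = W·(g·V_θ)` with step components `≤ τ`, `|E|·2√3·τ ≤ δ/4`, and every twisted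
orbit distance of `U` exceeds `δ/2`, then every twisted orbit distance of `V_θ` exceeds `δ/4`, hence `‖2θ_k‖ > √2δ/(12L³)` for some `k`. [cite: Luscher1983, §2] -/
theorem exists_norm_gt_of_valley_step {U W : GaugeConfig 3 L SU2} {g : Site 3 L → SU2} {θ : Fin 3 → ℝ} (hU : U = W * gaugeTransform g (abelianCfg L θ))
    (hs : ∀ e, 0 ≤ scalarPart (W e)) {τ δ : ℝ} (hw : ∀ (e : Edge 3 L) (c : Fin 3), |vecPart (W e) c| ≤ τ)
    (hsmall : Fintype.card (Edge 3 L) * (2 * Real.sqrt 3 * τ) ≤ δ / 4) (hval : ∀ z : Fin 3 → Bool, δ / 2 < orbitDist (TT.twist3 z U)) :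
    ∃ k : Fin 3, Real.sqrt 2 * (δ / 4) / (3 * (L : ℝ) ^ 3) < ‖((2 * θ k : ℝ) : AddCircle (2 * Real.pi / L))‖ := by
  subst hU
  refine exists_norm_gt_of_valley θ fun z => ?_
  have h1 := abs_orbitDist_twist3_sub_le z (W * gaugeTransform g (abelianCfg L θ)) (gaugeTransform g (abelianCfg L θ))
  have h2 := sum_frobNorm_step_sub_le W (gaugeTransform g (abelianCfg L θ)) hs hw
  have h3 : orbitDist (TT.twist3 z (gaugeTransform g (abelianCfg L θ))) = orbitDist (TT.twist3 z (abelianCfg L θ)) :=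
    orbitDist_twist3_gaugeTransform z g _
  have h4 := hval z
  rw [← h3]
  have := (abs_le.mp (h1.trans (h2.trans hsmall))).2
  linarith

/-! ## §2 The reduction -/

/-- ★★ **`ValleyGeomAt` from LINK PROXIMITY** (`c₀ = √2/(12L³)`). [cite: Luscher1983, §2–§3] -/
theorem valleyGeomAt_of_linkProx {δ η : ℝ → ℝ} (hP : ValleyLinkProxAt L δ η) (hδ0 : ∀ β, 0 < δ β) (hδ1 : ∀ β, δ β ≤ 1) : ValleyGeomAt L δ η := by
  have hL : (0 : ℝ) < L := by exact_mod_cast Nat.pos_of_ne_zero (NeZero.ne L)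
  set N : ℝ := Real.sqrt (Fintype.card (Plaquette 3 L × Fin 3)) with hN
  set E : ℝ := (Fintype.card (Edge 3 L) : ℝ) with hE
  refine ⟨Real.sqrt 2 / (12 * (L : ℝ) ^ 3), by positivity, fun ε hε => ?_⟩
  -- link tolerance: `τ = ε' δ` with `504 ε' √N ≤ ε`, `|E|·2√3·ε' ≤ 1/4`, `ε' ≤ 1`
  set ε' : ℝ := min (min (ε / (504 * N + 1)) (1 / (8 * Real.sqrt 3 * E + 1))) 1 with hε'
  have hε'0 : 0 < ε' := by rw [hε']; positivity
  have hε'1 : ε' ≤ 1 := min_le_right _ _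
  have hε'a : ε' ≤ ε / (504 * N + 1) := (min_le_left _ _).trans (min_le_left _ _)
  have hε'b : ε' ≤ 1 / (8 * Real.sqrt 3 * E + 1) := (min_le_left _ _).trans (min_le_right _ _)
  obtain ⟨β0, hβ0⟩ := hP ε' hε'0
  refine ⟨β0, fun β hβ U hU => ?_⟩
  obtain ⟨W, g, θ, hUeq, hs, hw⟩ := hβ0 β hβ U hU
  have hδ := hδ0 β
  -- (ii) the twist bound
  have hsmall : Fintype.card (Edge 3 L) * (2 * Real.sqrt 3 * (ε' * δ β)) ≤ δ β / 4 := by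
    rw [← hE]
    have h1 : ε' * (8 * Real.sqrt 3 * E + 1) ≤ 1 := by rwa [le_div_iff₀ (by positivity)] at hε'b
    nlinarith [Real.sqrt_nonneg 3, hδ, hε'0, (by positivity : (0:ℝ) ≤ E)]
  obtain ⟨k, hk⟩ := exists_norm_gt_of_valley_step hUeq hs hw hsmall (mem_valleySet_iff.mp hU).2
  refine ⟨g, θ, k, fun v => ?_, ?_⟩
  · -- (i) closeness of the covariant curls
    have hτ1 : ε' * δ β ≤ 1 := by
      calc ε' * δ β ≤ 1 * 1 := mul_le_mul hε'1 (hδ1 β) hδ.le zero_le_one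
        _ = 1 := one_mul _
    have hstep := norm_covCurl_step_sub_le (gaugeTransform g (abelianCfg L θ)) hτ1 hw v
    rw [hUeq]
    refine hstep.trans ?_
    rw [← hN]
    have h1 : ε' * (504 * N + 1) ≤ ε := by rwa [le_div_iff₀ (by positivity)] at hε'a
    have hv := norm_nonneg v
    have hN0 : 0 ≤ N := Real.sqrt_nonneg _
    nlinarith [mul_nonneg (mul_nonneg hN0 hδ.le) hv, mul_nonneg hδ.le hv]
  · have : Real.sqrt 2 / (12 * (L : ℝ) ^ 3) * δ β = Real.sqrt 2 * (δ β / 4) / (3 * (L : ℝ) ^ 3) := by field_simp; ring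
    rw [this]; exact hk.le

/-- `powScale p β ≤ 1` for `p ≥ 0`. [folklore] -/
theorem powScale_le_one {p : ℝ} (hp : 0 ≤ p) (β : ℝ) : powScale p β ≤ 1 := by
  unfold powScale
  exact Real.rpow_le_one_of_one_le_of_nonpos (le_max_right _ _) (by linarith)

/-- ★★★ **END TO END with the geometry in link currency**: COARSE-UPPER(L) from `ValleyBOAt`, `ValleyLinkProxAt` and the one-orbit INNER NO-INTRUDER at
`(δ, η) = (β^{−p}, β^{−q})`, `0 < p < 1/3`, `q < 8/9`. [cite: Luscher1983, §3] [cite: LuscherMunster1984, §2] -/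
theorem coarseNoIntruderAt_of_bo_linkProx_pow {p q : ℝ} (hp0 : 0 < p) (hp : p < 1 / 3) (hq : q < 8 / 9)
    (hBO : ValleyBOAt L (powScale p) (powScale q)) (hP : ValleyLinkProxAt L (powScale p) (powScale q)) (hI : InnerNoIntruderOneOrbitAt L (powScale p)) :
    ∀ k : ℕ, ∀ d : ℝ, d < levelGap k → ∃ lam0 : ℝ, 0 < lam0 ∧ ∀ lam : ℝ, 0 < lam → lam ≤ lam0 →
      ∀ β : ℝ, InFemtoWindow lam β L →
        levelValue su2Rep L β k ≤ Real.exp (-(d * luscherLambda β L) / L) * levelValue su2Rep L β 0 :=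
  coarseNoIntruderAt_of_bo_geom_pow hp0 hp hq hBO
    (valleyGeomAt_of_linkProx hP (fun β => powScale_pos p β) (fun β => powScale_le_one hp0.le β)) hI

end Summit.QuantumFields.YangMills.Theorems.FemtoTransferGap

end
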